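import Mathlib
import HarnessLib
import Literature.Analysis.FluidPDE.TaoAveragedNondegeneracy
import Literature.Analysis.FluidPDE.VectorCalculus
import Summits.NavierStokesRegularity.NavierStokesRegularity.Theorems.UnthreadedDoorNetFluxDefs
import Summits.NavierStokesRegularity.NavierStokesRegularity.Theorems.UnthreadedDoorNetFluxSphereSard

/-!
# Route `UnthreadedDoor`, crux `PoloidalLiouville` (stmt-NavierStokesRegularity-1222), WALL W1 — netflux line,
# NF-1a toolkit: THE LOCAL LEVEL CHART at a regular point of `f|_{S_r(x₀)}`

Tool for the research stub NF-1a `stub_extremalHeadEMF` (`NetFlux.ExtremalHeadEMF`) of the registered line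
`Cruxes/PoloidalLiouville/Lines/netflux_typei_gap.lean` (planner ns-idea-14; toolkit sub-stubs «Sard-constancy» (An1) and
(An2) of `netflux_typei_gap_nf1a_toolkit.lean`).  Setting: on the sphere `S = S_r(x₀)`, `r > 0`, `f, h ∈ C¹(ℝ³ ∖ {x₀})`,
`ν : ℝ³ → ℝ`, with the TANGENTIAL relation `∇h − ν∇f ∥ (x − x₀)` on `S` (`cross (∇h − ν∇f) (x − x₀) = 0`).

**`exists_levelChart`**: at a point `z ∈ S` where `f|_S` is regular (`∇f(z) × (z − x₀) ≠ 0`) there are an open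
neighbourhood `W ∋ z`, an `ε > 0` and a function `G : ℝ → ℝ` such that
* `h = G ∘ f` on `W ∩ S`, with `f(W ∩ S) ⊆ (f z − ε, f z + ε)`;
* every value `c ∈ (f z − ε, f z + ε)` is attained by `f` at a point `x_c ∈ W ∩ S` with `G′(c) = ν(x_c)`.
So near a regular point `h|_S` is a `C¹` function OF THE VALUES OF `f|_S`, with derivative `ν`: the local halves of the
level-constancy and of the level-Lipschitz lemma (Λ) of the NF-1a plan.

Proof: the inverse function theorem (`ContDiffAt.toOpenPartialHomeomorph`) for the chart
`F(x) = (‖x − x₀‖², f x, ⟪ℓ, x − x₀⟫)`, `ℓ = ∇f(z) × (z − x₀)`, whose derivative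
`w ↦ (2⟪x − x₀, w⟫, Df(x)w, ⟪ℓ, w⟫)` is injective exactly where the triple product `⟪(x − x₀) × ∇f(x), ℓ⟫ ≠ 0`
(`eq_zero_of_orthogonal_triple`); in the chart, `Ĥ(c,u) = h(F⁻¹(r², c, u))` has `∂_u Ĥ = ⟪∇h, τ_u⟫ = 0` (`τ_u ⊥ x − x₀`,
`⊥ ∇f`, and `∇h − ν∇f ∥ x − x₀`) and `∂_c Ĥ(c,0) = ⟪∇h, τ_c⟫ = ν` (`⟪∇f, τ_c⟫ = 1`); the mean value inequality in `u`
gives `Ĥ(c,u) = Ĥ(c,0) =: G(c)`.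

WHAT THIS IS NOT: no NS statement; `PoloidalLiouville` (1222), W1, the line's rung and NF-1a itself stay OPEN here.
`--supports stmt-NavierStokesRegularity-1222 --as helper`.  [folklore]
-/

noncomputable section

-- the summit and its single sub-problem share the name (CONVENTIONS §1)
set_option linter.dupNamespace false

open Set Function Filter Topology InnerProductSpace MeasureTheory Metric
open scoped RealInnerProductSpace ContDiff

namespace Summit.NavierStokesRegularity.NavierStokesRegularity.Theorems.PoloidalLiouville.NetFlux

open Literature.Analysis Literature.Analysis.FluidPDE

/-! ### Vector algebra -/

/-- A vector orthogonal to three vectors with nonzero triple product vanishes: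
`⟪a×b, c⟫ w = ⟪a,w⟫ (b×c) + ⟪b,w⟫ (c×a) + ⟪c,w⟫ (a×b)`. [folklore] -/
theorem eq_zero_of_orthogonal_triple {a b c w : E3} (ha : ⟪a, w⟫ = 0) (hb : ⟪b, w⟫ = 0) (hc : ⟪c, w⟫ = 0)
    (habc : ⟪cross a b, c⟫ ≠ 0) : w = 0 := by
  rw [Tao2016.real_inner_fin3] at ha hb hc habc
  rw [Tao2016.cross_apply_zero, Tao2016.cross_apply_one, Tao2016.cross_apply_two] at habc
  have h0 : w 0 * ((a 1 * b 2 - a 2 * b 1) * c 0 + (a 2 * b 0 - a 0 * b 2) * c 1 + (a 0 * b 1 - a 1 * b 0) * c 2) = 0 := by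
    linear_combination (b 1 * c 2 - b 2 * c 1) * ha + (c 1 * a 2 - c 2 * a 1) * hb + (a 1 * b 2 - a 2 * b 1) * hc
  have h1 : w 1 * ((a 1 * b 2 - a 2 * b 1) * c 0 + (a 2 * b 0 - a 0 * b 2) * c 1 + (a 0 * b 1 - a 1 * b 0) * c 2) = 0 := by
    linear_combination (b 2 * c 0 - b 0 * c 2) * ha + (c 2 * a 0 - c 0 * a 2) * hb + (a 2 * b 0 - a 0 * b 2) * hc
  have h2 : w 2 * ((a 1 * b 2 - a 2 * b 1) * c 0 + (a 2 * b 0 - a 0 * b 2) * c 1 + (a 0 * b 1 - a 1 * b 0) * c 2) = 0 := by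
    linear_combination (b 0 * c 1 - b 1 * c 0) * ha + (c 0 * a 1 - c 1 * a 0) * hb + (a 0 * b 1 - a 1 * b 0) * hc
  have e0 := (mul_eq_zero.1 h0).resolve_right habc
  have e1 := (mul_eq_zero.1 h1).resolve_right habc
  have e2 := (mul_eq_zero.1 h2).resolve_right habc
  ext i
  fin_cases i
  · simpa using e0
  · simpa using e1
  · simpa using e2

/-- Cyclic symmetry of the triple product: `⟪a × b, c⟫ = ⟪a, b × c⟫`. [folklore] -/
theorem inner_cross_left_eq_inner_cross_right (a b c : E3) : ⟪cross a b, c⟫ = ⟪a, cross b c⟫ := by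
  simp only [Tao2016.real_inner_fin3, Tao2016.cross_apply_zero, Tao2016.cross_apply_one, Tao2016.cross_apply_two]
  ring

/-- `cross b a = − cross a b`. [folklore] -/
theorem cross_swap (a b : E3) : cross b a = -cross a b := by
  simp only [cross, ← cross_anticomm (WithLp.ofLp a) (WithLp.ofLp b), WithLp.toLp_neg]

/-- An injective continuous linear map `ℝ³ → ℝ × ℝ × ℝ` is a continuous linear equivalence. [folklore] -/
theorem exists_equiv_of_injective (L : E3 →L[ℝ] ℝ × ℝ × ℝ) (hL : Injective L) :
    ∃ e : E3 ≃L[ℝ] ℝ × ℝ × ℝ, (e : E3 →L[ℝ] ℝ × ℝ × ℝ) = L := by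
  have hdim : Module.finrank ℝ E3 = Module.finrank ℝ (ℝ × ℝ × ℝ) := by
    simp [Module.finrank_prod]
  have hsurj : Surjective (L : E3 →ₗ[ℝ] ℝ × ℝ × ℝ) :=
    (LinearMap.injective_iff_surjective_of_finrank_eq_finrank hdim).1 hL
  refine ⟨(LinearEquiv.ofBijective (L : E3 →ₗ[ℝ] ℝ × ℝ × ℝ) ⟨hL, hsurj⟩).toContinuousLinearEquiv, ?_⟩
  ext w <;> rfl

/-! ### The chart and its inverse at points of the sphere -/

section Chart

variable {f h ν : E3 → ℝ} {x₀ : E3} {r : ℝ}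

/-- The derivative of the chart `F(x) = (‖x − x₀‖², f x, ⟪ℓ, x − x₀⟫)` at a point `x ≠ x₀`. [folklore] -/
theorem hasFDerivAt_chart (hf : ContDiffOn ℝ 1 f ({x₀}ᶜ : Set E3)) (ℓ : E3) {x : E3} (hx : x ≠ x₀) :
    HasFDerivAt (fun x : E3 => ((‖x - x₀‖ ^ 2, f x, ⟪ℓ, x - x₀⟫) : ℝ × ℝ × ℝ))
      ((2 • innerSL ℝ (x - x₀)).prod ((fderiv ℝ f x).prod (innerSL ℝ ℓ))) x := by
  have h1 : HasFDerivAt (fun x : E3 => ‖x - x₀‖ ^ 2) (2 • innerSL ℝ (x - x₀)) x := by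
    have := (hasStrictFDerivAt_norm_sq (x - x₀)).hasFDerivAt.comp x (hasFDerivAt_sub_const x₀)
    rw [ContinuousLinearMap.comp_id] at this
    exact this
  have h2 : HasFDerivAt f (fderiv ℝ f x) x :=
    ((hf.differentiableOn one_ne_zero x hx).differentiableAt (isOpen_compl_singleton.mem_nhds hx)).hasFDerivAt
  have h3 : HasFDerivAt (fun x : E3 => ⟪ℓ, x - x₀⟫) (innerSL ℝ ℓ) x := by
    have := (innerSL ℝ ℓ).hasFDerivAt.comp x (hasFDerivAt_sub_const x₀)
    rw [ContinuousLinearMap.comp_id] at this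
    exact this
  exact h1.prodMk (h2.prodMk h3)

/-- The chart is `C¹` at points `x ≠ x₀`. [folklore] -/
theorem contDiffAt_chart (hf : ContDiffOn ℝ 1 f ({x₀}ᶜ : Set E3)) (ℓ : E3) {x : E3} (hx : x ≠ x₀) :
    ContDiffAt ℝ 1 (fun x : E3 => ((‖x - x₀‖ ^ 2, f x, ⟪ℓ, x - x₀⟫) : ℝ × ℝ × ℝ)) x := by
  have h1 : ContDiffAt ℝ 1 (fun x : E3 => ‖x - x₀‖ ^ 2) x := (contDiffAt_id.sub contDiffAt_const).norm_sq ℝ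
  have h2 : ContDiffAt ℝ 1 f x := hf.contDiffAt (isOpen_compl_singleton.mem_nhds hx)
  have h3 : ContDiffAt ℝ 1 (fun x : E3 => ⟪ℓ, x - x₀⟫) x :=
    contDiffAt_const.inner ℝ (contDiffAt_id.sub contDiffAt_const)
  exact h1.prodMk (h2.prodMk h3)

/-- Where the triple product `⟪(x − x₀) × ∇f(x), ℓ⟫` is nonzero the chart derivative is injective. [folklore] -/
theorem injective_chartDeriv (ℓ : E3) {x : E3} (hx : ⟪cross (x - x₀) (gradient f x), ℓ⟫ ≠ 0) :
    Injective ((2 • innerSL ℝ (x - x₀)).prod ((fderiv ℝ f x).prod (innerSL ℝ ℓ))) := by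
  refine (injective_iff_map_eq_zero _).2 fun w hw => ?_
  have hw' : ⟪x, w⟫ - ⟪x₀, w⟫ = 0 ∧ fderiv ℝ f x w = 0 ∧ ⟪ℓ, w⟫ = 0 := by
    simpa [Prod.ext_iff] using hw
  obtain ⟨ha, hb, hc⟩ := hw'
  have ha' : ⟪x - x₀, w⟫ = 0 := by rwa [inner_sub_left]
  have hb' : ⟪gradient f x, w⟫ = 0 := by rw [inner_gradient_left (𝕜 := ℝ)]; exact hb
  exact eq_zero_of_orthogonal_triple ha' hb' hc hx

/-- **The local level chart at a regular point of `f|_{S_r(x₀)}`** (see the module docstring).  Hypotheses: `r > 0`,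
`f, h ∈ C¹(ℝ³ ∖ {x₀})`, `∇h − ν∇f ∥ (x − x₀)` on the sphere, `z ∈ S_r(x₀)` with `∇f(z) × (z − x₀) ≠ 0`.  Conclusion: an
open `W ∋ z`, an `ε > 0` and `G : ℝ → ℝ` with `f(W ∩ S) ⊆ (f z − ε, f z + ε)`, `h = G ∘ f` on `W ∩ S`, and for every
`c ∈ (f z − ε, f z + ε)` a point `x ∈ W ∩ S` with `f x = c` and `HasDerivAt G (ν x) c`. [folklore] -/
theorem exists_levelChart (hr : 0 < r) (hf : ContDiffOn ℝ 1 f ({x₀}ᶜ : Set E3)) (hh : ContDiffOn ℝ 1 h ({x₀}ᶜ : Set E3))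
    (hpar : ∀ x ∈ Metric.sphere x₀ r, cross (gradient h x - ν x • gradient f x) (x - x₀) = 0)
    {z : E3} (hz : z ∈ Metric.sphere x₀ r) (hreg : cross (gradient f z) (z - x₀) ≠ 0) :
    ∃ W : Set E3, IsOpen W ∧ z ∈ W ∧ ∃ ε > (0 : ℝ), ∃ G : ℝ → ℝ,
      (∀ x ∈ W, x ∈ Metric.sphere x₀ r → f x ∈ Ioo (f z - ε) (f z + ε) ∧ h x = G (f x)) ∧
      (∀ c ∈ Ioo (f z - ε) (f z + ε), ∃ x ∈ W, x ∈ Metric.sphere x₀ r ∧ f x = c ∧ HasDerivAt G (ν x) c) := by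
  classical
  have hzr : ‖z - x₀‖ = r := mem_sphere_iff_norm.1 hz
  have hz0 : z ≠ x₀ := fun h0 => by rw [h0, sub_self, norm_zero] at hzr; exact hr.ne' hzr.symm
  -- the normal `ℓ` to the chart's third coordinate
  set ℓ : E3 := cross (gradient f z) (z - x₀) with hℓ
  have hℓ0 : ℓ ≠ 0 := hreg
  -- the chart, its derivative field and the invertibility locus
  set F : E3 → ℝ × ℝ × ℝ := fun x => (‖x - x₀‖ ^ 2, f x, ⟪ℓ, x - x₀⟫) with hF
  set L : E3 → (E3 →L[ℝ] ℝ × ℝ × ℝ) := fun x =>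
    (2 • innerSL ℝ (x - x₀)).prod ((fderiv ℝ f x).prod (innerSL ℝ ℓ)) with hL
  have hLapply : ∀ x w, L x w = (2 * ⟪x - x₀, w⟫, fderiv ℝ f x w, ⟪ℓ, w⟫) := by
    intro x w
    simp [hL, inner_sub_left, mul_sub, two_mul]
  have hFd : ∀ x, x ≠ x₀ → HasFDerivAt F (L x) x := fun x hx => hasFDerivAt_chart hf ℓ hx
  set W₀ : Set E3 := {x | x ∈ ({x₀}ᶜ : Set E3) ∧ ⟪x - x₀, cross (gradient f x) ℓ⟫ ∈ ({0}ᶜ : Set ℝ)} with hW₀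
  have hW₀t : ∀ x ∈ W₀, ⟪cross (x - x₀) (gradient f x), ℓ⟫ ≠ 0 := fun x hx => by
    rw [inner_cross_left_eq_inner_cross_right]; exact hx.2
  have hgradc : ContinuousOn (gradient f) ({x₀}ᶜ : Set E3) := by
    have e : gradient f = fun x => (InnerProductSpace.toDual ℝ E3).symm (fderiv ℝ f x) := rfl
    rw [e]
    exact (InnerProductSpace.toDual ℝ E3).symm.continuous.comp_continuousOn
      (hf.continuousOn_fderiv_of_isOpen isOpen_compl_singleton le_rfl)
  have hW₀o : IsOpen W₀ := by
    have hc : ContinuousOn (fun x => ⟪x - x₀, cross (gradient f x) ℓ⟫) ({x₀}ᶜ : Set E3) := by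
      have hcr : ContinuousOn (fun x => (crossCLM.flip ℓ) (gradient f x)) ({x₀}ᶜ : Set E3) :=
        (crossCLM.flip ℓ).continuous.comp_continuousOn hgradc
      have hsub : Continuous fun x : E3 => x - x₀ := continuous_id.sub continuous_const
      exact (hsub.continuousOn.inner hcr).congr fun x _ => by
        simp only [ContinuousLinearMap.flip_apply, crossCLM_apply]
    exact hc.isOpen_inter_preimage isOpen_compl_singleton isOpen_compl_singleton
  have hzW₀ : z ∈ W₀ := by
    refine ⟨hz0, ?_⟩
    show ⟪z - x₀, cross (gradient f z) ℓ⟫ ∈ ({0}ᶜ : Set ℝ)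
    rw [mem_compl_singleton_iff, ← inner_cross_left_eq_inner_cross_right, cross_swap, hℓ.symm, inner_neg_left,
      neg_ne_zero, real_inner_self_eq_norm_sq]
    exact pow_ne_zero 2 (norm_ne_zero_iff.2 hℓ0)
  -- the open partial homeomorphism of the inverse function theorem at `z`
  obtain ⟨e, he⟩ := exists_equiv_of_injective (L z) (injective_chartDeriv ℓ (hW₀t z hzW₀))
  have hFz : HasFDerivAt F (e : E3 →L[ℝ] ℝ × ℝ × ℝ) z := by rw [he]; exact hFd z hz0
  have hFcz : ContDiffAt ℝ 1 F z := contDiffAt_chart hf ℓ hz0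
  obtain ⟨Φ, hΦF, hzs, hFzt⟩ : ∃ Φ : OpenPartialHomeomorph E3 (ℝ × ℝ × ℝ),
      (Φ : E3 → ℝ × ℝ × ℝ) = F ∧ z ∈ Φ.source ∧ F z ∈ Φ.target :=
    ⟨hFcz.toOpenPartialHomeomorph F hFz one_ne_zero, ContDiffAt.toOpenPartialHomeomorph_coe hFcz hFz one_ne_zero,
      ContDiffAt.mem_toOpenPartialHomeomorph_source hFcz hFz one_ne_zero,
      ContDiffAt.image_mem_toOpenPartialHomeomorph_target hFcz hFz one_ne_zero⟩
  have hsymm_z : Φ.symm (F z) = z := by rw [← hΦF]; exact Φ.left_inv hzs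
  -- a ball around `F z` in the target over which `Φ.symm` lands in `W₀`
  have hN : ∀ᶠ a in 𝓝 (F z), a ∈ Φ.target ∧ Φ.symm a ∈ W₀ := by
    exact Filter.Eventually.and (Φ.open_target.mem_nhds hFzt)
      ((Φ.continuousAt_symm hFzt).preimage_mem_nhds (by rw [hsymm_z]; exact hW₀o.mem_nhds hzW₀))
  obtain ⟨ε, hε, hball⟩ := Metric.eventually_nhds_iff_ball.1 hN
  have hFz_eq : F z = (r ^ 2, f z, 0) := by
    simp only [hF, hzr, hℓ, Tao2016.inner_cross_self_right]
  -- the slice points `a(c,u) = (r², c, u)` of the ball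
  have hmem : ∀ c u : ℝ, |c - f z| < ε → |u| < ε → ((r ^ 2, c, u) : ℝ × ℝ × ℝ) ∈ Metric.ball (F z) ε := by
    intro c u hc hu
    rw [Metric.mem_ball, hFz_eq, Prod.dist_eq, Prod.dist_eq, dist_self, Real.dist_eq, Real.dist_eq, sub_zero]
    exact max_lt_iff.2 ⟨by simpa using hε, max_lt_iff.2 ⟨hc, hu⟩⟩
  -- properties of `x = Φ.symm (r², c, u)`
  have hpt : ∀ c u : ℝ, |c - f z| < ε → |u| < ε →
      Φ.symm (r ^ 2, c, u) ∈ Φ.source ∧ Φ.symm (r ^ 2, c, u) ∈ W₀ ∧ Φ.symm (r ^ 2, c, u) ∈ Metric.sphere x₀ r ∧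
      f (Φ.symm (r ^ 2, c, u)) = c ∧ ⟪ℓ, Φ.symm (r ^ 2, c, u) - x₀⟫ = u := by
    intro c u hc hu
    obtain ⟨ht, hW⟩ := hball _ (hmem c u hc hu)
    have hFx : F (Φ.symm (r ^ 2, c, u)) = (r ^ 2, c, u) := by rw [← hΦF]; exact Φ.right_inv ht
    simp only [hF, Prod.mk.injEq] at hFx
    refine ⟨Φ.map_target ht, hW, ?_, hFx.2.1, hFx.2.2⟩
    rw [mem_sphere_iff_norm]
    nlinarith [hFx.1, norm_nonneg (Φ.symm (r ^ 2, c, u) - x₀), hr]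
  -- derivative of `Φ.symm` at slice points and the two chart directions
  have hdir : ∀ c u : ℝ, |c - f z| < ε → |u| < ε → ∃ D : ℝ × ℝ × ℝ →L[ℝ] E3, HasFDerivAt Φ.symm D (r ^ 2, c, u) ∧
      ⟪Φ.symm (r ^ 2, c, u) - x₀, D (0, 0, 1)⟫ = 0 ∧ fderiv ℝ f (Φ.symm (r ^ 2, c, u)) (D (0, 0, 1)) = 0 ∧
      ⟪Φ.symm (r ^ 2, c, u) - x₀, D (0, 1, 0)⟫ = 0 ∧ fderiv ℝ f (Φ.symm (r ^ 2, c, u)) (D (0, 1, 0)) = 1 := by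
    intro c u hc hu
    obtain ⟨ht, hW⟩ := hball _ (hmem c u hc hu)
    set x := Φ.symm (r ^ 2, c, u) with hx
    obtain ⟨ex, hex⟩ := exists_equiv_of_injective (L x) (injective_chartDeriv ℓ (hW₀t x hW))
    have hFx : HasFDerivAt Φ (ex : E3 →L[ℝ] ℝ × ℝ × ℝ) (Φ.symm (r ^ 2, c, u)) := by
      rw [hΦF, hex]; exact hFd x hW.1
    have hD := Φ.hasFDerivAt_symm ht hFx
    have h3 := hLapply x (ex.symm (0, 0, 1))
    rw [← hex, ContinuousLinearEquiv.coe_coe, ex.apply_symm_apply, Prod.mk.injEq, Prod.mk.injEq] at h3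
    have h2 := hLapply x (ex.symm (0, 1, 0))
    rw [← hex, ContinuousLinearEquiv.coe_coe, ex.apply_symm_apply, Prod.mk.injEq, Prod.mk.injEq] at h2
    refine ⟨(ex.symm : ℝ × ℝ × ℝ →L[ℝ] E3), hD, ?_, ?_, ?_, ?_⟩ <;> rw [ContinuousLinearEquiv.coe_coe]
    · linarith [h3.1]
    · exact h3.2.1.symm
    · linarith [h2.1]
    · exact h2.2.1.symm
  -- `⟪∇h(x), τ⟫ = ν(x) ⟪∇f(x), τ⟫` for tangent `τ` at sphere points
  have htan : ∀ x ∈ Metric.sphere x₀ r, ∀ τ : E3, ⟪x - x₀, τ⟫ = 0 →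
      fderiv ℝ h x τ = ν x * fderiv ℝ f x τ := by
    intro x hx τ hτ
    have hx0 : x - x₀ ≠ 0 := by
      intro h0
      have := mem_sphere_iff_norm.1 hx
      rw [h0, norm_zero] at this; exact hr.ne' this.symm
    have h0 := inner_eq_zero_of_cross_eq_zero_of_inner_eq_zero (hpar x hx) hτ hx0
    rw [inner_sub_left, inner_smul_left, inner_gradient_left (𝕜 := ℝ), inner_gradient_left (𝕜 := ℝ)] at h0
    simpa using (sub_eq_zero.1 h0)
  -- the chart function `Ĥ(c,u)` and `G(c) = Ĥ(c,0)`
  set G : ℝ → ℝ := fun c => h (Φ.symm (r ^ 2, c, 0)) with hG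
  -- (1) `u ↦ Ĥ(c,u)` has zero derivative
  have hHu : ∀ c u : ℝ, |c - f z| < ε → |u| < ε → HasDerivAt (fun t : ℝ => h (Φ.symm (r ^ 2, c, t))) 0 u := by
    intro c u hc hu
    obtain ⟨D, hD, h1, h2, -, -⟩ := hdir c u hc hu
    obtain ⟨-, hW, hS, -, -⟩ := hpt c u hc hu
    have hγ : HasDerivAt (fun t : ℝ => ((r ^ 2, c, t) : ℝ × ℝ × ℝ)) ((0, 0, 1) : ℝ × ℝ × ℝ) u :=
      (hasDerivAt_const u (r ^ 2)).prodMk ((hasDerivAt_const u c).prodMk (hasDerivAt_id u))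
    have hcomp := hD.comp_hasDerivAt u hγ
    have hhd : DifferentiableAt ℝ h (Φ.symm (r ^ 2, c, u)) :=
      (hh.differentiableOn one_ne_zero _ hW.1).differentiableAt (isOpen_compl_singleton.mem_nhds hW.1)
    have hfull := hhd.hasFDerivAt.comp_hasDerivAt u hcomp
    have hval : fderiv ℝ h (Φ.symm (r ^ 2, c, u)) (D (0, 0, 1)) = 0 := by
      rw [htan _ hS _ h1, h2, mul_zero]
    rw [hval] at hfull
    exact hfull
  -- (2) hence `Ĥ(c,u) = G(c)`
  have hHG : ∀ c u : ℝ, |c - f z| < ε → |u| < ε → h (Φ.symm (r ^ 2, c, u)) = G c := by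
    intro c u hc hu
    have hseg : ∀ t ∈ uIcc 0 u, |t| < ε := fun t ht => by
      rcases le_total 0 u with h0u | hu0
      · rw [uIcc_of_le h0u] at ht; rw [abs_lt]; constructor <;> [linarith [ht.1]; linarith [ht.2, (abs_lt.1 hu).2]]
      · rw [uIcc_of_ge hu0] at ht; rw [abs_lt]; constructor <;> [linarith [ht.1, (abs_lt.1 hu).1]; linarith [ht.2]]
    have hmv := Convex.norm_image_sub_le_of_norm_hasDerivWithin_le (f := fun t : ℝ => h (Φ.symm (r ^ 2, c, t)))
      (f' := fun _ => (0 : ℝ)) (C := 0) (s := uIcc 0 u)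
      (fun t ht => (hHu c t hc (hseg t ht)).hasDerivWithinAt) (fun t _ => by simp) (convex_uIcc 0 u)
      left_mem_uIcc right_mem_uIcc
    rw [zero_mul, norm_le_zero_iff, sub_eq_zero] at hmv
    exact hmv
  -- (3) `G' (c) = ν (x_c)`
  have hGd : ∀ c : ℝ, |c - f z| < ε → HasDerivAt G (ν (Φ.symm (r ^ 2, c, 0))) c := by
    intro c hc
    have hu : |(0 : ℝ)| < ε := by simpa using hε
    obtain ⟨D, hD, -, -, h1, h2⟩ := hdir c 0 hc hu
    obtain ⟨-, hW, hS, -, -⟩ := hpt c 0 hc hu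
    have hγ : HasDerivAt (fun s : ℝ => ((r ^ 2, s, 0) : ℝ × ℝ × ℝ)) ((0, 1, 0) : ℝ × ℝ × ℝ) c :=
      (hasDerivAt_const c (r ^ 2)).prodMk ((hasDerivAt_id c).prodMk (hasDerivAt_const c 0))
    have hcomp := hD.comp_hasDerivAt c hγ
    have hhd : DifferentiableAt ℝ h (Φ.symm (r ^ 2, c, 0)) :=
      (hh.differentiableOn one_ne_zero _ hW.1).differentiableAt (isOpen_compl_singleton.mem_nhds hW.1)
    have hfull := hhd.hasFDerivAt.comp_hasDerivAt c hcomp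
    have hval : fderiv ℝ h (Φ.symm (r ^ 2, c, 0)) (D (0, 1, 0)) = ν (Φ.symm (r ^ 2, c, 0)) := by
      rw [htan _ hS _ h1, h2, mul_one]
    rw [hval] at hfull
    exact hfull
  -- the neighbourhood `W`
  set W : Set E3 := (Φ.source ∩ ({x₀}ᶜ : Set E3)) ∩
    (fun x => (f x, ⟪ℓ, x - x₀⟫)) ⁻¹' (Metric.ball (f z) ε ×ˢ Metric.ball (0 : ℝ) ε) with hWdef
  have hWo : IsOpen W := by
    have hsub : Continuous fun x : E3 => ⟪ℓ, x - x₀⟫ := continuous_const.inner (continuous_id.sub continuous_const)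
    have hc : ContinuousOn (fun x => (f x, ⟪ℓ, x - x₀⟫)) (Φ.source ∩ ({x₀}ᶜ : Set E3)) :=
      (hf.continuousOn.mono inter_subset_right).prodMk hsub.continuousOn
    exact hc.isOpen_inter_preimage (Φ.open_source.inter isOpen_compl_singleton)
      (Metric.isOpen_ball.prod Metric.isOpen_ball)
  have hzW : z ∈ W := by
    refine ⟨⟨hzs, hz0⟩, ?_⟩
    show (f z, ⟪ℓ, z - x₀⟫) ∈ Metric.ball (f z) ε ×ˢ Metric.ball (0 : ℝ) ε
    rw [hℓ, Tao2016.inner_cross_self_right]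
    exact ⟨Metric.mem_ball_self hε, Metric.mem_ball_self hε⟩
  refine ⟨W, hWo, hzW, ε, hε, G, fun x hxW hxS => ?_, fun c hc => ?_⟩
  · -- `h x = G (f x)` on `W ∩ S`
    obtain ⟨⟨hxs, hx0⟩, hxB⟩ := hxW
    have hxB' : (f x, ⟪ℓ, x - x₀⟫) ∈ Metric.ball (f z) ε ×ˢ Metric.ball (0 : ℝ) ε := hxB
    rw [mem_prod, Metric.mem_ball, Metric.mem_ball, Real.dist_eq, Real.dist_eq, sub_zero] at hxB'
    have hxr : ‖x - x₀‖ = r := mem_sphere_iff_norm.1 hxS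
    have hFx : F x = (r ^ 2, f x, ⟪ℓ, x - x₀⟫) := by simp only [hF, hxr]
    have hsx : Φ.symm (r ^ 2, f x, ⟪ℓ, x - x₀⟫) = x := by rw [← hFx, ← hΦF]; exact Φ.left_inv hxs
    refine ⟨?_, ?_⟩
    · rw [mem_Ioo]; constructor <;> linarith [(abs_lt.1 hxB'.1).1, (abs_lt.1 hxB'.1).2]
    · rw [← hHG (f x) ⟪ℓ, x - x₀⟫ hxB'.1 hxB'.2, hsx]
  · -- every value near `f z` is attained in `W ∩ S`, with `G' = ν`
    have hc' : |c - f z| < ε := by rw [abs_lt]; rw [mem_Ioo] at hc; constructor <;> linarith [hc.1, hc.2]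
    have hu : |(0 : ℝ)| < ε := by simpa using hε
    obtain ⟨hs, hW0, hS, hfc, hℓc⟩ := hpt c 0 hc' hu
    refine ⟨Φ.symm (r ^ 2, c, 0), ⟨⟨hs, hW0.1⟩, ?_⟩, hS, hfc, hGd c hc'⟩
    show (f (Φ.symm (r ^ 2, c, 0)), ⟪ℓ, Φ.symm (r ^ 2, c, 0) - x₀⟫) ∈ Metric.ball (f z) ε ×ˢ Metric.ball (0 : ℝ) ε
    rw [hfc, hℓc]
    exact ⟨by rw [Metric.mem_ball, Real.dist_eq]; exact hc', Metric.mem_ball_self hε⟩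

end Chart

end Summit.NavierStokesRegularity.NavierStokesRegularity.Theorems.PoloidalLiouville.NetFlux

end
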